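/-
Copyright (c) 2026 the pub-hodgecm-mathlib formalisation cell (harness21).  Prover seat hodgecm-mathlib-LH4-p19 (g4), req620 Track A «(D-RAM) FOUR-FRAME» squad
((β₂) road (R-36) «PURE-CELL LEDGER», lane C (RamM) LOWER-LINE RAY BAND ‹HL_RAY_C♭› — the KIT (split with LH4-p10 (g10) 04:18:40Z «=»), file KIT-1: the cell letters of a
lower-line cell from SIZE TOKENS, lane-free), 2026-09-05.
-/
import Summits.HodgeConjecture.HodgeConjecture.Theorems.F0P3cDyRamUpperRayCellLettersGen    -- ★ p865071 G4 (LH7-p10 (g3)): the upper-line TOKENS model; brings ★ F3 `…UpperLineCellCentre` (centre ∕ slope identities, Eisenstein), ★ `v_map_le_pow_iff`, ★ `v_map_eq_one_iff`∕`v_map_eq_map_pow_iff`, ★ Lit `v_eq_one_of_v_mul_map_eq_one`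
import HarnessLib

/-!
# Crux `H413`, line LH4 «(D-RAM) FOUR-FRAME» — the (β₂) road (R-36), (OFF) residue, LOWER line, BOTH ∕ ALL lanes: «THE CELL LETTERS OF A LOWER-LINE CELL FROM SIZE TOKENS» —
# ★ LH7-p09 `…LowerLineCellLetters.exists_cellLetters_lowerLine` ∕ ★ p865285 `…AnyRadius` with the isometry letter `hjiso : |jE a| = |a|` and the `exp`-size letters REMOVED:
# the sizes enter as the two tokens `|μ| = |jEϖ|^{mE}`, `|κ_c| = |ξ₀|·|jEϖ|^{mE − 2b − d%2}` (the pattern of ★ G4 `…UpperRayCellLettersGen`); conclusion = ★'s eight letters BYTE FOR BYTE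

Cell `hodgecm-mathlib` (D-0151), FLOOR 0, crux item H413 = `stmt-HodgeConjecture-24833`, route of record `HCCMUnconditional`; squads F0∕P3c∕LH4 ∕ LH7; lane
`--supports stmt-HodgeConjecture-24833 --as helper` (count-neutral; pays NO tier-0 row).  THEOREMS ONLY (no `def`, no instance, no notation, no `sorry`, default heartbeats);
★-only imports; states NO law; (β₂), ‹HL_RAY_C♭› stay HYPOTHESES of their consumers.

WHY (lane-C desk pointer LH4-p04 (g10) 04:15:42Z; LH7-p10 (g3) LANEC-RAY-PORT-PLAN §2 step 7 + HANDOFF «lower line: clone LH7-p09's R2 with the Gen kit»; split LH4-p19 = KIT ∕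
LH4-p10 = WORKER 04:18:40Z).  The lower-line worker of lane B (★ LH7-p09 `cellDiff_lowerLine_eq_zero_of_le`) and of lane A (★ p865319) take the cell letters `W BE γ₁ W₁` from
★ `exists_cellLetters_lowerLine[_of_radius]`, whose proof reads `hjiso` to move the sizes `|μ| = e^{−m}`, `|μ − ρμ| = e^{−jl}`, `|ξ₀| = e^{r}` between `E` and `M`.  In lane C
(type RamM) `|jE a| = |a|²`, so — exactly as ★ G4 did for the upper line — the sizes must enter as TOKENS in `|jEϖ|`-powers and cross to `E` through `hjv` (★ `v_map_eq_map_pow_iff`,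
★ `v_map_le_pow_iff`): `hμv : |μ| = |jEϖ|^{mE}` (`mE` = the depth in `E`-units: lane B `mE = m`, lane C `m = 2mE` by ★ `depth_even_of_letters_ramM`) and the centre token
`hκc : |κ_c| = |ξ₀|·|jEϖ|^{mE − 2b − d%2}` (`κ_c = ρμ∕(ρμ − μ)`, `|κ_c| = e^{jl − m}`; on the lower line `jl_E = j + b + d%2` and the reference pair sits at the cell radius, so
`|κ_c|∕|ξ₀| = |jEϖ|^{mE − 2b − d%2}` in every lane).  Then `|jE BE| = |μ − ρμ|·|ξ₀| = |jEϖ|^{2b + d%2}` (★ F3 `v_skew_mul_centre_defect`), so `|BE| = |ϖ|^{2b+d%2}` and the slope ratio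
`θ = BE∕(P·t₊)` is a UNIT (`|γ₁| = 1`); `|jE(W − σW)|·|ξ₀| = |κ_c|·|μ|` gives `|W − σW| = |ϖ|^{2mE − 2b − d%2}` and the Eisenstein `W₁` with `|γ₁(W − W₁)| ≤ |ϖ|^{2d−1}` from the bands
`2b + d%2 < mE`, `3d − 2 + d%2 ≤ mE`; `|W| ≤ 1` from `|κ_c| ≤ |ξ₀|` and `|κ₀| ≤ |ξ₀|`.  Every other line is ★ p865285's, VERBATIM.
* HEAD `exists_cellLetters_lowerLine_of_tokens` — binders in ★ G4's ORDER (`hD jE hjv hjfix hΘj hρρ hvρ hΘρ hΘlam hvlam hdet hlam2 hρlam hlam3 huu hu hμv hμρ` bands `κ₀ ξ₀` letters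
  `hκ₀v hκc`); conclusion = ★ `exists_cellLetters_lowerLine`'s eight letters BYTE FOR BYTE (`jE W·ξ₀ = κ_c − κ₀`; `jE BE = (μ − ρμ)·ξ₀`; `σγ₁ = γ₁`; `σW₁ = W₁`; SLOPE; ROOT; `|γ₁| = 1`;
  `|W₁| ≤ 1`).  Lane B recovers ★ p865285 (`hμv`, `hκc` from `hm hjl hξv hjiso`); lane C's worker (LH4-p10) supplies the tokens from the ‹OFF_C.letter.v2› block.
WHAT IS NOT CLAIMED: the reference pair, the tokens, any read, any count, any census law.
HONEST LABEL.  Count-neutral field ∕ valuation algebra; nothing printed is asserted; no census law is stated; ‹HL_RAY_C♭›, ‹HL_MIX_C♭›, β₂ `stub_law_cleanSgn₂` UNPROVED; `HC_CM` is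
proved only modulo the 7 printed citations (2 remaining named inputs: hLiu418 = `stmt-HodgeConjecture-24832`, h413 = `stmt-HodgeConjecture-24833`) until rung 0 closes.
## References
* [Kottwitz1986BaseChangeUnits] R. E. Kottwitz, *Base change for unit elements of Hecke algebras*, Compositio Math. 60 (1986): §3 (the cell constants of a cone cell).
* [Serre1979] J.-P. Serre, *Local Fields*, GTM 67 (1979): Ch. III §6 Prop. 12 (Eisenstein coordinates), Ch. V §3, Ch. XV §2.
* [Rogawski1990] J. D. Rogawski, *Automorphic Representations of Unitary Groups in Three Variables*, Ann. of Math. Stud. 123 (1990): §4.9 Prop. 4.9.1 (b) p. 55, §12.2.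
-/

set_option autoImplicit false

noncomputable section

namespace Summit.HodgeConjecture.HodgeConjecture.Cruxes.H413.F0P3cDyRamLowerLineCellLettersTokens

open scoped Valued WithZero
open WithZero
open Literature.NumberTheory.Automorphic.UnitaryThreeFourFrame (IsRamifiedQuadraticDatum)
open Literature.NumberTheory.LocalFields.WildQuadraticDatum (v_eq_one_of_v_mul_map_eq_one)
open Literature.NumberTheory.Rogawski1990
open Summit.HodgeConjecture.HodgeConjecture.Cruxes.H413.F0P3cDyRamToricCensusDefs
open Summit.HodgeConjecture.HodgeConjecture.Cruxes.H413.F0P3cDyRamUpperLineCellCentre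
open Summit.HodgeConjecture.HodgeConjecture.Cruxes.H413.F0P3cDyRamDiagonalCellCleanRegime (v_map_le_pow_iff)
open Summit.HodgeConjecture.HodgeConjecture.Cruxes.H413.F0P3cDyRamBoundaryCellLetterCardTwo (v_map_eq_one_iff v_map_eq_map_pow_iff)

variable {E M : Type} [Field E] [Valued E ℤᵐ⁰] [Field M] [Valued M ℤᵐ⁰] {ρ Θ : M →+* M}

/-- **HEAD — «THE CELL LETTERS OF A LOWER-LINE CELL, FROM SIZE TOKENS» (all lanes).**  Frame = ★ G4 `exists_cellLetters_of_tokens`'s (`E`-datum, `jE`-letters through `hjv`,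
involution letters, the line model `lam` with `Θlam·lam = 1`, `det·σdet = 1`, `lam² = tr·lam − det`, `ρlam = tr − lam`, `|lam − 1| ≤ |jEϖ|^{3d−2}`, the unit `u` with `uσu = 1`);
`μ = lam − jE u` with the depth token `|μ| = |jEϖ|^{mE}` and `ρμ ≠ μ`; the LOWER-LINE bands `2b + d%2 < mE`, `3d − 2 + d%2 ≤ mE`; the reference pair `κ₀, ξ₀` (`κ₀ + ρκ₀ = 1`,
`Θκ₀ = κ₀`, `ρξ₀ = −ξ₀`, `Θξ₀ = ξ₀ ≠ 0`, `|κ₀| ≤ |ξ₀|`) and the centre token `|κ_c| = |ξ₀|·|jEϖ|^{mE − 2b − d%2}` (`κ_c = ρμ∕(ρμ − μ)`).  THEN `∃ W BE γ₁ W₁ : E` with ★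
`exists_cellLetters_lowerLine`'s eight letters: `jE W·ξ₀ = κ_c − κ₀`; `jE BE = (μ − ρμ)·ξ₀`; `σγ₁ = γ₁`; `σW₁ = W₁`; `|BE∕(P·t₊) − γ₁| ≤ |γ₁|·|ϖ|^{2d−1}`; `|γ₁(W − W₁)| ≤ |ϖ|^{2d−1}`;
`|γ₁| = 1`; `|W₁| ≤ 1` (`P = (ϖσϖ)^b`, `t₊ = (ϖ − σϖ)·((ϖσϖ)^{(d−d%2)∕2})⁻¹`).
[cite: Kottwitz1986BaseChangeUnits, §3] [cite: Serre1979, Ch. III §6 Prop. 12; Ch. XV §2] [cite: Rogawski1990, §4.9 Prop. 4.9.1 (b) p. 55] -/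
theorem exists_cellLetters_lowerLine_of_tokens {σ : E →+* E} {ϖ : E} {d tE : ℕ} (hD : IsRamifiedQuadraticDatum σ ϖ d tE)
    (jE : E →+* M) (hjv : ∀ c, Valued.v (jE c) ≤ 1 ↔ Valued.v c ≤ 1) (hjfix : ∀ z, ρ z = z ↔ ∃ c, jE c = z) (hΘj : ∀ c, Θ (jE c) = jE (σ c))
    (hρρ : ∀ x, ρ (ρ x) = x) (hvρ : ∀ x, Valued.v (ρ x) = Valued.v x) (hΘρ : ∀ x, Θ (ρ x) = ρ (Θ x))
    {lam : M} (hΘlam : Θ lam * lam = 1) (hvlam : Valued.v lam = 1)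
    {tr det : E} (hdet : det * σ det = 1) (hlam2 : lam * lam = jE tr * lam - jE det) (hρlam : ρ lam = jE tr - lam)
    (hlam3 : Valued.v (lam - 1) ≤ Valued.v (jE ϖ) ^ (3 * d - 2))
    {u : E} (huu : u * σ u = 1) (hu : Valued.v u = 1)
    {mE : ℕ} (hμv : Valued.v (lam - jE u) = Valued.v (jE ϖ) ^ mE) (hμρ : ρ (lam - jE u) ≠ lam - jE u)
    {b : ℕ} (h2bm : 2 * b + d % 2 < mE) (hmc : 3 * d - 2 + d % 2 ≤ mE)
    {κ₀ ξ₀ : M} (hκ₀ : κ₀ + ρ κ₀ = 1) (hΘκ₀ : Θ κ₀ = κ₀) (hξ : ρ ξ₀ = -ξ₀) (hΘξ : Θ ξ₀ = ξ₀) (hξ0 : ξ₀ ≠ 0)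
    (hκ₀v : Valued.v κ₀ ≤ Valued.v ξ₀)
    (hκc : Valued.v (ρ (lam - jE u) / (ρ (lam - jE u) - (lam - jE u))) = Valued.v ξ₀ * Valued.v (jE ϖ) ^ (mE - 2 * b - d % 2)) :
    ∃ W BE γ₁ W₁ : E,
      jE W * ξ₀ = ρ (lam - jE u) / (ρ (lam - jE u) - (lam - jE u)) - κ₀ ∧
      jE BE = ((lam - jE u) - ρ (lam - jE u)) * ξ₀ ∧ σ γ₁ = γ₁ ∧ σ W₁ = W₁ ∧
      Valued.v (BE / ((ϖ * σ ϖ) ^ b * ((ϖ - σ ϖ) * ((ϖ * σ ϖ) ^ ((d - d % 2) / 2))⁻¹)) - γ₁) ≤ Valued.v γ₁ * Valued.v ϖ ^ (2 * d - 1) ∧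
      Valued.v (γ₁ * (W - W₁)) ≤ Valued.v ϖ ^ (2 * d - 1) ∧
      Valued.v γ₁ = 1 ∧ Valued.v W₁ ≤ 1 := by
  obtain ⟨hσσ, hvσ, hϖ, -, hd, hd1, -⟩ := id hD
  have hvϖ0 : Valued.v ϖ ≠ 0 := by rw [hϖ]; exact exp_ne_zero
  have hϖ0 : ϖ ≠ 0 := fun h0 => hvϖ0 (by rw [h0, map_zero])
  have hϖpos : (0 : ℤᵐ⁰) < Valued.v ϖ := zero_lt_iff.2 hvϖ0
  have hϖlt : Valued.v ϖ < 1 := by rw [hϖ, ← exp_zero, exp_lt_exp]; norm_num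
  have hσϖ0 : σ ϖ ≠ 0 := (map_ne_zero σ).2 hϖ0
  have hPnE : ∀ k : ℕ, Valued.v ϖ ^ k = exp (-(k : ℤ)) := fun k => by rw [hϖ, ← exp_nsmul]; congr 1; simp
  have hρj : ∀ c : E, ρ (jE c) = jE c := fun c => (hjfix _).2 ⟨c, rfl⟩
  have hϖσ : σ ϖ ≠ ϖ := fun h => by rw [h, sub_self, map_zero] at hd; exact pow_ne_zero _ hvϖ0 hd.symm
  have hξpos : (0 : ℤᵐ⁰) < Valued.v ξ₀ := zero_lt_iff.2 ((Valuation.ne_zero_iff _).2 hξ0)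
  have hju : Valued.v (jE u) = 1 := (v_map_eq_one_iff jE hjv u).2 hu
  have hjϖ0 : Valued.v (jE ϖ) ≠ 0 := (Valuation.ne_zero_iff _).2 ((map_ne_zero jE).2 hϖ0)
  have hjϖ1 : Valued.v (jE ϖ) ≤ 1 := (hjv ϖ).2 hϖlt.le
  -- the token exponent `e = mE − 2b − d%2` and the two `|jEϖ|`-powers `qe = |jEϖ|^e`, `qs = |jEϖ|^{2b + d%2}` (`|μ| = qe·qs`, `|κ_c| = |ξ₀|·qe`)
  have he : mE - 2 * b - d % 2 + (2 * b + d % 2) = mE := by omega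
  obtain ⟨qe, hqe⟩ : ∃ qe : ℤᵐ⁰, qe = Valued.v (jE ϖ) ^ (mE - 2 * b - d % 2) := ⟨_, rfl⟩
  obtain ⟨qs, hqs⟩ : ∃ qs : ℤᵐ⁰, qs = Valued.v (jE ϖ) ^ (2 * b + d % 2) := ⟨_, rfl⟩
  have hqe0 : qe ≠ 0 := by rw [hqe]; exact pow_ne_zero _ hjϖ0
  have hqs0 : qs ≠ 0 := by rw [hqs]; exact pow_ne_zero _ hjϖ0
  have hqe1 : qe ≤ 1 := by rw [hqe]; exact pow_le_one₀ zero_le hjϖ1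
  have hqmE : Valued.v (jE ϖ) ^ mE = qe * qs := by rw [hqe, hqs, ← pow_add, he]
  have hμqq : Valued.v (lam - jE u) = qe * qs := hμv.trans hqmE
  rw [← hqe] at hκc
  have hκcle : Valued.v (ρ (lam - jE u) / (ρ (lam - jE u) - (lam - jE u))) ≤ Valued.v ξ₀ := by
    rw [hκc]; exact mul_le_of_le_one_right' hqe1
  -- the centre coordinate and the slope
  obtain ⟨W, hWc⟩ := exists_centre_coord jE hjfix hρρ hμρ hκ₀ hξ hξ0
  have hρB : ρ (((lam - jE u) - ρ (lam - jE u)) * ξ₀) = ((lam - jE u) - ρ (lam - jE u)) * ξ₀ := by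
    rw [map_mul, map_sub, hρρ, hξ]; ring
  obtain ⟨BE, hBE⟩ := (hjfix _).1 hρB
  -- determinant letters
  have hdetv : Valued.v det = 1 := v_eq_one_of_v_mul_map_eq_one hvσ (by rw [hdet]; exact map_one _)
  have hdet0 : det ≠ 0 := fun h0 => by rw [h0, map_zero] at hdetv; exact zero_ne_one hdetv
  have hll : lam * ρ lam = jE det := by
    have e : lam * ρ lam = jE tr * lam - lam * lam := by rw [hρlam]; ring
    rw [e, hlam2]; ring
  have hdet1 : Valued.v (det - 1) ≤ Valued.v ϖ ^ (3 * d - 2) := by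
    refine (v_map_le_pow_iff jE hjv hϖ0 (det - 1) (3 * d - 2)).1 ?_
    rw [map_sub, map_one, ← hll]
    have e : lam * ρ lam - 1 = (lam - 1) * ρ lam + ρ (lam - 1) := by rw [map_sub, map_one]; ring
    rw [e]
    refine (Valuation.map_add _ _ _).trans (max_le ?_ ?_)
    · rw [Valuation.map_mul, hvρ, hvlam, mul_one]; exact hlam3
    · rw [hvρ]; exact hlam3
  -- `σ` of the slope: `σB = −B ∕ det`
  have hσBE : σ BE = -BE / det := jE.injective (by
    rw [← hΘj, map_div₀, map_neg, hBE, map_mul, hΘξ, ← hll, map_skew_eq_neg_div σ jE hΘj hρj hΘρ hΘlam huu]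
    field_simp)
  set P : E := (ϖ * σ ϖ) ^ b with hPdef
  set tp : E := (ϖ - σ ϖ) * ((ϖ * σ ϖ) ^ ((d - d % 2) / 2))⁻¹ with htpdef
  have hσP : σ P = P := by rw [hPdef, map_pow, map_mul, hσσ, mul_comm (σ ϖ) ϖ]
  have hσtp : σ tp = -tp := by
    rw [htpdef, map_mul, map_inv₀, map_pow, map_mul, map_sub, hσσ, mul_comm (σ ϖ) ϖ]; ring
  have hP0 : P ≠ 0 := pow_ne_zero _ (mul_ne_zero hϖ0 hσϖ0)
  have hPv : Valued.v P = Valued.v ϖ ^ (2 * b) := by rw [hPdef, Valuation.map_pow, Valuation.map_mul, hvσ, ← pow_two, ← pow_mul]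
  have htpv : Valued.v tp = Valued.v ϖ ^ (d % 2) := by
    have h1 : Valued.v tp * Valued.v ϖ ^ (2 * ((d - d % 2) / 2)) = Valued.v ϖ ^ d := by
      rw [htpdef, Valuation.map_mul, Valuation.map_inv, Valuation.map_pow, Valuation.map_mul, hvσ, ← pow_two, ← pow_mul, hd,
        inv_mul_cancel_right₀ (pow_ne_zero _ hvϖ0)]
    have h2 : Valued.v ϖ ^ d = Valued.v ϖ ^ (d % 2) * Valued.v ϖ ^ (2 * ((d - d % 2) / 2)) := by rw [← pow_add]; congr 1; omega
    exact mul_right_cancel₀ (pow_ne_zero _ hvϖ0) (h1.trans h2)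
  have htp0 : tp ≠ 0 := fun h0 => by rw [h0, map_zero] at htpv; exact pow_ne_zero _ hvϖ0 htpv.symm
  -- the slope ratio `θ` and its `σ`
  set θ : E := BE / (P * tp) with hθdef
  have hBE0 : BE ≠ 0 := fun h0 => by
    have : ((lam - jE u) - ρ (lam - jE u)) * ξ₀ = 0 := by rw [← hBE, h0, map_zero]
    exact mul_ne_zero (sub_ne_zero.2 (Ne.symm hμρ)) hξ0 this
  have hθ0 : θ ≠ 0 := div_ne_zero hBE0 (mul_ne_zero hP0 htp0)
  have hθpos : (0 : ℤᵐ⁰) < Valued.v θ := zero_lt_iff.2 ((Valuation.ne_zero_iff _).2 hθ0)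
  have hσθ : σ θ = θ / det := by
    rw [hθdef, map_div₀, map_mul, hσBE, hσP, hσtp]; field_simp
  have hθσv : Valued.v (θ - σ θ) ≤ Valued.v θ * Valued.v ϖ ^ (3 * d - 2) := by
    have e : θ - σ θ = θ * ((det - 1) / det) := by rw [hσθ]; field_simp
    rw [e, Valuation.map_mul, map_div₀ _ (det - 1) det, hdetv, div_one]; exact mul_le_mul' le_rfl hdet1
  -- Eisenstein approximation of the slope ratio
  obtain ⟨γ₁, hσγ, hγ⟩ := exists_fixed_v_sub_mul_eq hσσ hϖσ θ
  have hθγ : Valued.v (θ - γ₁) ≤ Valued.v θ * Valued.v ϖ ^ (2 * d - 1) := by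
    have h1 : Valued.v (θ - γ₁) * Valued.v ϖ ^ d ≤ Valued.v θ * Valued.v ϖ ^ (2 * d - 1) * Valued.v ϖ ^ d := by
      rw [← hd, hγ]
      calc Valued.v (θ - σ θ) * Valued.v ϖ ≤ Valued.v θ * Valued.v ϖ ^ (3 * d - 2) * Valued.v ϖ := mul_le_mul' hθσv le_rfl
        _ = Valued.v θ * Valued.v ϖ ^ (2 * d - 1) * Valued.v (ϖ - σ ϖ) := by
          rw [hd, mul_assoc, mul_assoc, ← pow_succ, ← pow_add]; congr 2; omega
    have h2 := (div_le_iff₀ (pow_pos hϖpos d)).2 h1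
    rwa [mul_div_assoc, div_self (pow_ne_zero _ hvϖ0), mul_one] at h2
  have h2d1 : Valued.v ϖ ^ (2 * d - 1) < 1 := pow_lt_one₀ zero_le hϖlt (by omega)
  have hθlt : Valued.v (θ - γ₁) < Valued.v θ :=
    hθγ.trans_lt (by
      calc Valued.v θ * Valued.v ϖ ^ (2 * d - 1) < Valued.v θ * 1 := mul_lt_mul_of_pos_left h2d1 hθpos
        _ = Valued.v θ := mul_one _)
  have hγv : Valued.v γ₁ = Valued.v θ := by
    have e : γ₁ = θ - (θ - γ₁) := by ring
    rw [e, Valuation.map_sub_eq_of_lt_left _ hθlt]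
  -- the size of the slope from the tokens: `|jE BE|·(|κ_c|·|μ|) = |μ|²·|ξ₀|` (★ F3) ⟹ `|jE BE| = |jEϖ|^{2b + d%2}` ⟹ `|BE| = |ϖ|^{2b + d%2}` ⟹ `|θ| = 1`
  have hjBv : Valued.v (jE BE) = Valued.v (jE ϖ) ^ (2 * b + d % 2) := by
    have h1 := v_skew_mul_centre_defect hvρ hμρ ξ₀
    rw [← hBE, hκc, hμqq, pow_two] at h1
    have h2 : qs * (Valued.v ξ₀ * qe * (qe * qs)) = qe * qs * (qe * qs) * Valued.v ξ₀ := by ac_rfl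
    rw [← hqs]
    exact mul_right_cancel₀ (mul_ne_zero (mul_ne_zero (ne_of_gt hξpos) hqe0) (mul_ne_zero hqe0 hqs0)) (h1.trans h2.symm)
  have hBEv : Valued.v BE = Valued.v ϖ ^ (2 * b + d % 2) := (v_map_eq_map_pow_iff jE hjv hϖ0 BE (2 * b + d % 2)).1 hjBv
  have hθv : Valued.v θ = 1 := by
    rw [hθdef, Valuation.map_div, Valuation.map_mul, hBEv, hPv, htpv, ← pow_add, div_self (pow_ne_zero _ hvϖ0)]
  -- the root: `|jE(W − σW)|·|ξ₀| = |κ_c|·|μ|` ⟹ `|W − σW| = |ϖ|^{2mE − 2b − d%2}`, Eisenstein `W₁`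
  have hWσ : Valued.v (W - σ W) = Valued.v ϖ ^ (mE - 2 * b - d % 2 + mE) := by
    refine (v_map_eq_map_pow_iff jE hjv hϖ0 (W - σ W) (mE - 2 * b - d % 2 + mE)).1 ?_
    have h1 := map_centre_coord_sub σ jE hΘj hΘκ₀ hΘξ hWc
    have h3 : ρ (lam - jE u) / (ρ (lam - jE u) - (lam - jE u)) - Θ (ρ (lam - jE u) / (ρ (lam - jE u) - (lam - jE u))) =
        -(ρ (lam - jE u) / (ρ (lam - jE u) - (lam - jE u)) * ((lam - jE u) / jE u)) := by
      rw [← neg_sub, map_centre_sub_centre σ jE hΘj hρj hΘρ hΘlam huu hμρ]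
    have h2 : Valued.v (jE (W - σ W)) * Valued.v ξ₀ = qe * (qe * qs) * Valued.v ξ₀ := by
      rw [← Valuation.map_mul, h1.trans h3, Valuation.map_neg, Valuation.map_mul, hκc, Valuation.map_div, hμqq, hju, div_one]; ac_rfl
    rw [pow_add, hqmE, ← hqe]
    exact mul_right_cancel₀ (ne_of_gt hξpos) h2
  obtain ⟨W₁, hσW₁, hW1⟩ := exists_fixed_v_sub_mul_eq hσσ hϖσ W
  have hWWv : Valued.v (W - W₁) = exp (-((mE - 2 * b - d % 2 + mE : ℕ) : ℤ) - 1 + d) := by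
    have h1 : Valued.v (W - W₁) * exp (-(d : ℤ)) = exp (-((mE - 2 * b - d % 2 + mE : ℕ) : ℤ) + (-1)) := by
      rw [← hPnE, ← hd, hW1, hWσ, hPnE, hϖ, exp_add]
    rw [(eq_mul_inv_iff_mul_eq₀ exp_ne_zero).2 h1, ← exp_neg, ← exp_add]; congr 1; ring
  have hWW : Valued.v (γ₁ * (W - W₁)) ≤ Valued.v ϖ ^ (2 * d - 1) := by
    rw [Valuation.map_mul, hγv, hθv, one_mul, hWWv, hPnE, exp_le_exp]; push_cast; omega
  have hWle : Valued.v W ≤ 1 := by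
    refine (hjv W).1 ?_
    have h1 : Valued.v (jE W) * Valued.v ξ₀ ≤ 1 * Valued.v ξ₀ := by
      rw [← Valuation.map_mul, hWc, one_mul]
      exact (Valuation.map_sub _ _ _).trans (max_le hκcle hκ₀v)
    have h2 := (le_div_iff₀ hξpos).2 h1
    rwa [mul_div_assoc, div_self (ne_of_gt hξpos), mul_one] at h2
  have hW₁1 : Valued.v W₁ ≤ 1 := by
    have e : W₁ = W - (W - W₁) := by ring
    rw [e]
    refine (Valuation.map_sub _ _ _).trans (max_le hWle ?_)
    rw [hWWv, ← exp_zero, exp_le_exp]; push_cast; omega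
  have hγ1 : Valued.v γ₁ = 1 := by rw [hγv, hθv]
  exact ⟨W, BE, γ₁, W₁, hWc, hBE, hσγ, hσW₁, by rw [hγv]; exact hθγ, hWW, hγ1, hW₁1⟩

end Summit.HodgeConjecture.HodgeConjecture.Cruxes.H413.F0P3cDyRamLowerLineCellLettersTokens

end
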